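import Summits.AnomalousDissipation.AnomalousDissipation.Theorems.SolenoidalFractalHomogenisationLagrangianStepCellLawVQSSpectralFaces
import Summits.AnomalousDissipation.AnomalousDissipation.Theorems.SolenoidalFractalHomogenisationLagrangianStepOneLevelDefsFamily
import HarnessLib

/-!
# K1L `LagrangianRenormalisationStep(Design)` (K1L_D, stmt-AnomalousDissipation-27980), stub `stub_cellLawV0_IS`, IS-half obligation
# `stub_W_evenSlackB` — the EIGEN-CENTRED PER-SLOT EVEN STEP: from the order interval `S⋆/λ ≼ S ≼ λS⋆` to two-sided bounds on the slot
# response `pᵀ f_T(B̂_s(S)) P_s p` in terms of the reference block `B̂_s(S⋆)` (helper; `--supports … --as helper`; word-independent)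

Summits-side helper file of route `SolenoidalFractalHomogenisation` (prover seat `ad-sawtooth-k1loc-p1` g12; E1 even certificate of the IS-half line of
record `Cruxes/LagrangianRenormalisationStep/Lines/onelevel_W_crossing.lean` v2, planner ad-ideate-p5 g12).  The even clause
`EvenSlackOnInterval (a • excQS W M) S⋆ λ₀ Λ τ₀ δ` is a statement about `symb (excQS W M S) k p = Σ_s coef_s (e_s·k)² · pᵀ Q_s(S) p`
(`symb_excQS`), `Q_s(S) = f_{T_s}(B̂_s(S)) P_s`, `B̂_s(S) = regBlock S m̂_s`.  This file does the per-slot work for SYMMETRIC inputs (`OddSmall S 0`):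
* §1 `regBlock_quad` — `wᵀ B̂(S,n) w = σ_S(n, P_n w) + (n·w)²` for a unit `n` (any `S`), with `projPerp_mulVec_self`, `regBlock_mulVec_self`;
* §2 the LOEWNER SANDWICH from the order interval: `InInterval S⋆ λ S`, `λ ≥ 1` ⟹ `(1/λ)·B̂(S⋆,n) ≤ B̂(S,n) ≤ λ·B̂(S⋆,n)`
  (`regBlock_loewner_lower/upper_of_inInterval`), and the floor/ceiling `α/λ ≤ B̂(S,n) ≤ λβ` from a slot window `α ≤ σ_{S⋆}(n,·) ≤ β` on `n^⊥`
  with `α/λ ≤ 1 ≤ λβ` (`regBlock_floor/ceiling_of_inInterval`);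
* §3 the per-slot pinch with a BLOCK window (scalar-class slots; the landed `…QSBlock` pinch with `NearIso` replaced by the window at `n`):
  `slotForm_le_of_window` / `le_slotForm_of_window`, and from the interval: `f_T(λβ)|P_n p|² ≤ pᵀQ(S)p ≤ f_T(α/λ)|P_n p|²` (`slotForm_le/ge_of_inInterval`);
* §4 the ANISOTROPIC per-slot step ((110)-class slots): with an orthonormal eigenbasis `(q_k, β_k > 0)` of the reference block `B̂(S⋆,n)`,
  `pᵀQ(S)p ≤ λϑ_∞ Σ_k (q_k·P_n p)²/β_k − r_T(λβ)|P_n p|²` and `pᵀQ(S)p ≥ (ϑ_∞/λ) Σ_k (q_k·P_n p)²/β_k − r_T(α/λ)|P_n p|²`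
  (`slotForm_le/ge_of_inInterval_eig`; the refined faces of `…CellLawVQSSpectralFaces`).
Everything PROVED, no definition, no named fact, no sorry.  Infrastructure for rung leaf F-D1.A0; NOT a proof of the stub, of the crux, of Onsager's
conjecture or of anomalous dissipation.
-/

set_option linter.dupNamespace false

noncomputable section

namespace Summit.AnomalousDissipation.AnomalousDissipation.Theorems.SolenoidalFractalHomogenisation.LagrangianStep

open Literature.Analysis Literature.Analysis.FluidPDE Literature.Analysis.FunctionSpaces
open MeasureTheory Set Real Matrix

variable {S Sstar : Torus.Visc4 (Fin 3)} {n : Fin 3 → ℝ}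

/-! ## §1 The quadratic form of the regularised block for a general vector -/

section Quad

/-- `P_n n = 0` for a unit `n`. [folklore] -/
theorem projPerp_mulVec_self (hn : ∑ a, n a ^ 2 = 1) : (projPerp n).mulVec n = 0 := by
  funext i
  rw [projPerp_mulVec]
  have h : ∑ j, n j * n j = 1 := by rw [← hn]; exact Finset.sum_congr rfl fun j _ => by rw [sq]
  rw [h, mul_one, sub_self]
  rfl

/-- `n` is a (right) eigenvector of the regularised block: `B̂(S,n) n = n` for a unit `n` (any `S`). [folklore] -/
theorem regBlock_mulVec_self (hn : ∑ a, n a ^ 2 = 1) (S : Torus.Visc4 (Fin 3)) : (regBlock S n).mulVec n = n := by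
  rw [regBlock, Matrix.add_mulVec, ← Matrix.mulVec_mulVec, ← Matrix.mulVec_mulVec, projPerp_mulVec_self hn,
    Matrix.mulVec_zero, Matrix.mulVec_zero, zero_add]
  funext i
  simp only [Matrix.mulVec, dotProduct, Matrix.vecMulVec_apply, mul_assoc, ← Finset.mul_sum]
  have h : ∑ j, n j * n j = 1 := by rw [← hn]; exact Finset.sum_congr rfl fun j _ => by rw [sq]
  rw [h, mul_one]

/-- **The quadratic form of the regularised block**: `wᵀ B̂(S,n) w = σ_S(n, P_n w) + (n·w)²` for a unit `n` and every `w`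
(the cross terms vanish: `nᵀB̂ = nᵀ`, `B̂n = n`, `n ⊥ P_n w`). [folklore] -/
theorem regBlock_quad (hn : ∑ a, n a ^ 2 = 1) (S : Torus.Visc4 (Fin 3)) (w : Fin 3 → ℝ) :
    ∑ i, ∑ j, w i * regBlock S n i j * w j = Torus.symb S n ((projPerp n).mulVec w) + (∑ i, n i * w i) ^ 2 := by
  set u := (projPerp n).mulVec w with hu
  set c := ∑ j, n j * w j with hc
  have hw : ∀ i, w i = u i + c * n i := fun i => by rw [hu, projPerp_mulVec]; ring
  have hperp : ∑ i, n i * u i = 0 := sum_mul_projPerp_mulVec hn w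
  have hleft : ∀ j, ∑ i, n i * regBlock S n i j = 1 * n j := regBlock_left_eig hn
  have hright : ∀ i, ∑ j, regBlock S n i j * n j = n i := by
    intro i
    have h := congrArg (fun z => z i) (regBlock_mulVec_self hn S)
    simpa only [Matrix.mulVec, dotProduct] using h
  have huu : ∑ i, ∑ j, u i * regBlock S n i j * u j = Torus.symb S n u := sum_sum_mul_regBlock_mul_of_perp hperp
  have hA : ∑ i, ∑ j, n i * regBlock S n i j * u j = 0 := by
    rw [Finset.sum_comm]
    simp only [← Finset.sum_mul, hleft, one_mul]
    exact hperp
  have hB : ∑ i, ∑ j, u i * regBlock S n i j * n j = 0 := by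
    have h1 : ∀ i, ∑ j, u i * regBlock S n i j * n j = u i * n i := fun i => by
      simp only [mul_assoc, ← Finset.mul_sum, hright i]
    simp only [h1]
    rw [← hperp]; exact Finset.sum_congr rfl fun i _ => mul_comm _ _
  have hC : ∑ i, ∑ j, n i * regBlock S n i j * n j = 1 := by
    rw [Finset.sum_comm]
    simp only [← Finset.sum_mul, hleft, one_mul]
    rw [← hn]; exact Finset.sum_congr rfl fun j _ => by rw [sq]
  have hexp : ∀ i j, (u i + c * n i) * regBlock S n i j * (u j + c * n j)
      = u i * regBlock S n i j * u j + c * (n i * regBlock S n i j * u j) + c * (u i * regBlock S n i j * n j)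
        + c ^ 2 * (n i * regBlock S n i j * n j) := fun i j => by ring
  calc ∑ i, ∑ j, w i * regBlock S n i j * w j
      = ∑ i, ∑ j, (u i + c * n i) * regBlock S n i j * (u j + c * n j) := by
        refine Finset.sum_congr rfl fun i _ => Finset.sum_congr rfl fun j _ => ?_
        rw [← hw i, ← hw j]
    _ = ∑ i, ∑ j, u i * regBlock S n i j * u j + c * ∑ i, ∑ j, n i * regBlock S n i j * u j
        + c * ∑ i, ∑ j, u i * regBlock S n i j * n j + c ^ 2 * ∑ i, ∑ j, n i * regBlock S n i j * n j := by
        simp only [hexp, Finset.sum_add_distrib, ← Finset.mul_sum]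
    _ = Torus.symb S n u + c ^ 2 := by rw [huu, hA, hB, hC]; ring

/-- `|w|² = |P_n w|² + (n·w)²` for a unit `n`. [folklore] -/
theorem sum_sq_eq_projPerp_add (hn : ∑ a, n a ^ 2 = 1) (w : Fin 3 → ℝ) :
    ∑ i, w i ^ 2 = ∑ i, ((projPerp n).mulVec w i) ^ 2 + (∑ i, n i * w i) ^ 2 := by
  rw [sum_sq_projPerp_mulVec hn]
  have h : ∑ i, w i * n i = ∑ i, n i * w i := Finset.sum_congr rfl fun i _ => mul_comm _ _
  rw [h]; ring

end Quad

/-! ## §2 The Loewner sandwich of the regularised block from the order interval -/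

section Sandwich

/-- `P_n w ⊥ n` in the orientation `TransLE` consumes. [folklore] -/
theorem sum_projPerp_mulVec_mul (hn : ∑ a, n a ^ 2 = 1) (w : Fin 3 → ℝ) :
    ∑ i, (projPerp n).mulVec w i * n i = 0 := by
  rw [← sum_mul_projPerp_mulVec hn w]
  exact Finset.sum_congr rfl fun i _ => mul_comm _ _

/-- **Loewner sandwich, lower**: `InInterval S⋆ λ S` with `λ ≥ 1` gives `(1/λ)·B̂(S⋆,n) ≤ B̂(S,n)` (unit `n`). [folklore] -/
theorem regBlock_loewner_lower_of_inInterval (hn : ∑ a, n a ^ 2 = 1) {lam : ℝ} (hlam : 1 ≤ lam)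
    (hI : InInterval Sstar lam S) (w : Fin 3 → ℝ) :
    ∑ i, ∑ j, w i * ((1 / lam) • regBlock Sstar n) i j * w j ≤ ∑ i, ∑ j, w i * regBlock S n i j * w j := by
  have hsm : ∑ i, ∑ j, w i * ((1 / lam) • regBlock Sstar n) i j * w j = (1 / lam) * ∑ i, ∑ j, w i * regBlock Sstar n i j * w j := by
    simp only [Matrix.smul_apply, smul_eq_mul, Finset.mul_sum]
    exact Finset.sum_congr rfl fun i _ => Finset.sum_congr rfl fun j _ => by ring
  rw [hsm, regBlock_quad hn, regBlock_quad hn]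
  have h1 := hI.1 n ((projPerp n).mulVec w) (sum_projPerp_mulVec_mul hn w)
  rw [Torus.symb_smul] at h1
  have hl0 : 0 < lam := by linarith
  have h2 : (1 / lam) * (∑ i, n i * w i) ^ 2 ≤ (∑ i, n i * w i) ^ 2 :=
    mul_le_of_le_one_left (sq_nonneg _) (by rw [div_le_one hl0]; exact hlam)
  nlinarith

/-- **Loewner sandwich, upper**: `InInterval S⋆ λ S` with `λ ≥ 1` gives `B̂(S,n) ≤ λ·B̂(S⋆,n)` (unit `n`). [folklore] -/
theorem regBlock_loewner_upper_of_inInterval (hn : ∑ a, n a ^ 2 = 1) {lam : ℝ} (hlam : 1 ≤ lam)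
    (hI : InInterval Sstar lam S) (w : Fin 3 → ℝ) :
    ∑ i, ∑ j, w i * regBlock S n i j * w j ≤ ∑ i, ∑ j, w i * (lam • regBlock Sstar n) i j * w j := by
  have hsm : ∑ i, ∑ j, w i * (lam • regBlock Sstar n) i j * w j = lam * ∑ i, ∑ j, w i * regBlock Sstar n i j * w j := by
    simp only [Matrix.smul_apply, smul_eq_mul, Finset.mul_sum]
    exact Finset.sum_congr rfl fun i _ => Finset.sum_congr rfl fun j _ => by ring
  rw [hsm, regBlock_quad hn, regBlock_quad hn]
  have h1 := hI.2 n ((projPerp n).mulVec w) (sum_projPerp_mulVec_mul hn w)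
  rw [Torus.symb_smul] at h1
  have h2 : (∑ i, n i * w i) ^ 2 ≤ lam * (∑ i, n i * w i) ^ 2 := le_mul_of_one_le_left (sq_nonneg _) hlam
  nlinarith

/-- **Floor from the interval and a slot window**: `α ≤ σ_{S⋆}(n,·)` on `n^⊥` (per unit `|w|²`), `α/λ ≤ 1` ⟹ `(α/λ)|w|² ≤ wᵀB̂(S,n)w`. [folklore] -/
theorem regBlock_floor_of_inInterval (hn : ∑ a, n a ^ 2 = 1) {lam α : ℝ} (hlam : 1 ≤ lam) (hαl : α / lam ≤ 1)
    (hα : ∀ w : Fin 3 → ℝ, ∑ i, n i * w i = 0 → α * ∑ i, w i ^ 2 ≤ Torus.symb Sstar n w)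
    (hI : InInterval Sstar lam S) (w : Fin 3 → ℝ) :
    α / lam * ∑ i, w i ^ 2 ≤ ∑ i, ∑ j, w i * regBlock S n i j * w j := by
  have hl0 : 0 < lam := by linarith
  rw [regBlock_quad hn, sum_sq_eq_projPerp_add hn w]
  have h1 := hI.1 n ((projPerp n).mulVec w) (sum_projPerp_mulVec_mul hn w)
  rw [Torus.symb_smul] at h1
  have h2 := hα ((projPerp n).mulVec w) (sum_mul_projPerp_mulVec hn w)
  have h3 : α / lam * ∑ i, ((projPerp n).mulVec w i) ^ 2 ≤ 1 / lam * Torus.symb Sstar n ((projPerp n).mulVec w) := by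
    rw [div_eq_mul_one_div, mul_comm α, mul_assoc]
    exact mul_le_mul_of_nonneg_left h2 (by positivity)
  have h4 : α / lam * (∑ i, n i * w i) ^ 2 ≤ (∑ i, n i * w i) ^ 2 := mul_le_of_le_one_left (sq_nonneg _) hαl
  nlinarith

/-- **Ceiling from the interval and a slot window**: `σ_{S⋆}(n,·) ≤ β` on `n^⊥`, `1 ≤ λβ` ⟹ `wᵀB̂(S,n)w ≤ λβ|w|²`. [folklore] -/
theorem regBlock_ceiling_of_inInterval (hn : ∑ a, n a ^ 2 = 1) {lam β : ℝ} (hlam : 1 ≤ lam) (hβl : 1 ≤ lam * β)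
    (hβ : ∀ w : Fin 3 → ℝ, ∑ i, n i * w i = 0 → Torus.symb Sstar n w ≤ β * ∑ i, w i ^ 2)
    (hI : InInterval Sstar lam S) (w : Fin 3 → ℝ) :
    ∑ i, ∑ j, w i * regBlock S n i j * w j ≤ lam * β * ∑ i, w i ^ 2 := by
  have hl0 : 0 < lam := by linarith
  rw [regBlock_quad hn, sum_sq_eq_projPerp_add hn w]
  have h1 := hI.2 n ((projPerp n).mulVec w) (sum_projPerp_mulVec_mul hn w)
  rw [Torus.symb_smul] at h1
  have h2 := hβ ((projPerp n).mulVec w) (sum_mul_projPerp_mulVec hn w)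
  have h3 : lam * Torus.symb Sstar n ((projPerp n).mulVec w) ≤ lam * β * ∑ i, ((projPerp n).mulVec w i) ^ 2 := by
    rw [mul_assoc]; exact mul_le_mul_of_nonneg_left h2 hl0.le
  have h4 : (∑ i, n i * w i) ^ 2 ≤ lam * β * (∑ i, n i * w i) ^ 2 := le_mul_of_one_le_left (sq_nonneg _) hβl
  nlinarith

/-- Eigen-data of a scaled matrix. [folklore] -/
theorem smul_mulVec_of_eig {B : Matrix (Fin 3) (Fin 3) ℝ} {q : Fin 3 → ℝ} {β : ℝ} (h : B.mulVec q = β • q) (c : ℝ) :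
    (c • B).mulVec q = (c * β) • q := by
  rw [Matrix.smul_mulVec, h, smul_smul]

end Sandwich

/-! ## §3 The per-slot pinch with a block window (scalar-class slots) -/

section Window

/-- Upper pinch with a block window at `n`: `lo|w|² ≤ wᵀB̂(S,n)w` on `n^⊥` ⟹ `pᵀ (f_T(B̂) P_n) p ≤ f_T(lo)·|P_n p|²` (`OddSmall S 0`, `T ≥ 0`). [folklore] -/
theorem slotForm_le_of_window (hS : Torus.OddSmall S 0) (hn : ∑ a, n a ^ 2 = 1) {lo : ℝ}
    (hlo : ∀ w : Fin 3 → ℝ, ∑ i, n i * w i = 0 → lo * ∑ i, w i ^ 2 ≤ ∑ i, ∑ j, w i * regBlock S n i j * w j)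
    {ρ T : ℝ} (hT : 0 ≤ T) (p : Fin 3 → ℝ) :
    ∑ i, ∑ j, p i * (qsResp ρ T (regBlock S n) * projPerp n) i j * p j ≤
      qsRespScalar ρ T lo * (∑ i, p i ^ 2 - (∑ i, p i * n i) ^ 2) := by
  rw [sum_sum_mul_qsResp_regBlock_projPerp hn, ← sum_sq_projPerp_mulVec hn]
  exact sum_sum_mul_qsResp_mul_le hT fun τ hτ =>
    sum_mul_exp_neg_smul_mulVec_le_of_perp (regBlock_isSymm hS hn) (regBlock_left_eig hn) hlo (sum_mul_projPerp_mulVec hn p) hτ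

/-- Lower pinch with a block window at `n`: `wᵀB̂(S,n)w ≤ hi|w|²` on `n^⊥` ⟹ `f_T(hi)·|P_n p|² ≤ pᵀ (f_T(B̂) P_n) p`. [folklore] -/
theorem le_slotForm_of_window (hS : Torus.OddSmall S 0) (hn : ∑ a, n a ^ 2 = 1) {hi : ℝ}
    (hhi : ∀ w : Fin 3 → ℝ, ∑ i, n i * w i = 0 → ∑ i, ∑ j, w i * regBlock S n i j * w j ≤ hi * ∑ i, w i ^ 2)
    {ρ T : ℝ} (hT : 0 ≤ T) (p : Fin 3 → ℝ) :
    qsRespScalar ρ T hi * (∑ i, p i ^ 2 - (∑ i, p i * n i) ^ 2) ≤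
      ∑ i, ∑ j, p i * (qsResp ρ T (regBlock S n) * projPerp n) i j * p j := by
  rw [sum_sum_mul_qsResp_regBlock_projPerp hn, ← sum_sq_projPerp_mulVec hn]
  exact le_sum_sum_mul_qsResp_mul hT fun τ hτ =>
    le_sum_mul_exp_neg_smul_mulVec_of_perp (regBlock_isSymm hS hn) (regBlock_left_eig hn) hhi (sum_mul_projPerp_mulVec hn p) hτ

/-- **Per-slot even step, scalar-class form (upper)**: `InInterval S⋆ λ S`, `λ ≥ 1`, slot window floor `α` of `S⋆` at `n` (`α/λ ≤ 1`)
⟹ `pᵀ Q(S) p ≤ f_T(α/λ)·|P_n p|²`. [folklore] -/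
theorem slotForm_le_of_inInterval (hS : Torus.OddSmall S 0) (hn : ∑ a, n a ^ 2 = 1) {lam α : ℝ} (hlam : 1 ≤ lam)
    (hαl : α / lam ≤ 1) (hα : ∀ w : Fin 3 → ℝ, ∑ i, n i * w i = 0 → α * ∑ i, w i ^ 2 ≤ Torus.symb Sstar n w)
    (hI : InInterval Sstar lam S) {ρ T : ℝ} (hT : 0 ≤ T) (p : Fin 3 → ℝ) :
    ∑ i, ∑ j, p i * (qsResp ρ T (regBlock S n) * projPerp n) i j * p j ≤
      qsRespScalar ρ T (α / lam) * (∑ i, p i ^ 2 - (∑ i, p i * n i) ^ 2) :=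
  slotForm_le_of_window hS hn (fun w _ => regBlock_floor_of_inInterval hn hlam hαl hα hI w) hT p

/-- **Per-slot even step, scalar-class form (lower)**: slot window ceiling `β` of `S⋆` at `n` (`1 ≤ λβ`) ⟹ `f_T(λβ)·|P_n p|² ≤ pᵀ Q(S) p`. [folklore] -/
theorem slotForm_ge_of_inInterval (hS : Torus.OddSmall S 0) (hn : ∑ a, n a ^ 2 = 1) {lam β : ℝ} (hlam : 1 ≤ lam)
    (hβl : 1 ≤ lam * β) (hβ : ∀ w : Fin 3 → ℝ, ∑ i, n i * w i = 0 → Torus.symb Sstar n w ≤ β * ∑ i, w i ^ 2)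
    (hI : InInterval Sstar lam S) {ρ T : ℝ} (hT : 0 ≤ T) (p : Fin 3 → ℝ) :
    qsRespScalar ρ T (lam * β) * (∑ i, p i ^ 2 - (∑ i, p i * n i) ^ 2) ≤
      ∑ i, ∑ j, p i * (qsResp ρ T (regBlock S n) * projPerp n) i j * p j :=
  le_slotForm_of_window hS hn (fun w _ => regBlock_ceiling_of_inInterval hn hlam hβl hβ hI w) hT p

end Window

/-! ## §4 The anisotropic per-slot step against the reference block's eigenbasis -/

section Eig

/-- **Per-slot even step, anisotropic form (upper)**: `OddSmall S 0`, `OddSmall S⋆ 0`, `InInterval S⋆ λ S`, `λ ≥ 1`, slot window `[α, β]` of `S⋆`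
at the unit `n` with `0 < α`, `α/λ ≤ 1 ≤ λβ`; `(q_k, β_k > 0)` an orthonormal eigenbasis of `B̂(S⋆,n)`; `T > 0`, `0 < ρ ≤ 1/2`.  Then
`pᵀ Q(S) p ≤ λ·ϑ_∞·Σ_k (q_k·P_n p)²/β_k − r_T(λβ)·|P_n p|²`. [folklore] -/
theorem slotForm_le_of_inInterval_eig (hS : Torus.OddSmall S 0) (hSstar : Torus.OddSmall Sstar 0) (hn : ∑ a, n a ^ 2 = 1)
    {lam α β : ℝ} (hlam : 1 ≤ lam) (hα0 : 0 < α) (hαl : α / lam ≤ 1) (hβl : 1 ≤ lam * β)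
    (hα : ∀ w : Fin 3 → ℝ, ∑ i, n i * w i = 0 → α * ∑ i, w i ^ 2 ≤ Torus.symb Sstar n w)
    (hβ : ∀ w : Fin 3 → ℝ, ∑ i, n i * w i = 0 → Torus.symb Sstar n w ≤ β * ∑ i, w i ^ 2)
    (hI : InInterval Sstar lam S)
    (q : OrthonormalBasis (Fin 3) ℝ (EuclideanSpace ℝ (Fin 3))) (βk : Fin 3 → ℝ)
    (hq : ∀ k, (regBlock Sstar n).mulVec (q k) = βk k • ⇑(q k)) (hβk : ∀ k, 0 < βk k)
    {ρ T : ℝ} (hρ : 0 < ρ) (hρ2 : ρ ≤ 1 / 2) (hT : 0 < T) (p : Fin 3 → ℝ) :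
    ∑ i, ∑ j, p i * (qsResp ρ T (regBlock S n) * projPerp n) i j * p j ≤
      lam * (1 - 4 * ρ / 3) * ∑ k, (∑ i, q k i * (projPerp n).mulVec p i) ^ 2 / βk k
        - ((1 - 4 * ρ / 3) / (lam * β) - qsRespScalar ρ T (lam * β)) * (∑ i, p i ^ 2 - (∑ i, p i * n i) ^ 2) := by
  have hl0 : 0 < lam := by linarith
  rw [sum_sum_mul_qsResp_regBlock_projPerp hn, ← sum_sq_projPerp_mulVec hn]
  set v := (projPerp n).mulVec p with hv
  have hB0symm : ((1 / lam) • regBlock Sstar n).IsSymm := (regBlock_isSymm hSstar hn).smul _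
  have hq0 : ∀ k, ((1 / lam) • regBlock Sstar n).mulVec (q k) = (fun k => 1 / lam * βk k) k • ⇑(q k) :=
    fun k => smul_mulVec_of_eig (hq k) _
  have h := sum_sum_mul_qsResp_mul_le_of_loewner' (regBlock_isSymm hS hn) hB0symm (div_pos hα0 hl0)
    (regBlock_floor_of_inInterval hn hlam hαl hα hI) (regBlock_ceiling_of_inInterval hn hlam hβl hβ hI)
    (regBlock_loewner_lower_of_inInterval hn hlam hI) q (fun k => 1 / lam * βk k) hq0
    (fun k => mul_pos (by positivity) (hβk k)) hρ hρ2 hT v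
  have e : (1 - 4 * ρ / 3) * ∑ k, (∑ i, q k i * v i) ^ 2 / (1 / lam * βk k)
      = lam * (1 - 4 * ρ / 3) * ∑ k, (∑ i, q k i * v i) ^ 2 / βk k := by
    rw [Finset.mul_sum, Finset.mul_sum]
    refine Finset.sum_congr rfl fun k _ => ?_
    have hk := (hβk k).ne'
    field_simp
  rw [e] at h
  exact h

/-- **Per-slot even step, anisotropic form (lower)**: same setting; `pᵀ Q(S) p ≥ (ϑ_∞/λ)·Σ_k (q_k·P_n p)²/β_k − r_T(α/λ)·|P_n p|²`. [folklore] -/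
theorem slotForm_ge_of_inInterval_eig (hS : Torus.OddSmall S 0) (hSstar : Torus.OddSmall Sstar 0) (hn : ∑ a, n a ^ 2 = 1)
    {lam α : ℝ} (hlam : 1 ≤ lam) (hα0 : 0 < α) (hαl : α / lam ≤ 1)
    (hα : ∀ w : Fin 3 → ℝ, ∑ i, n i * w i = 0 → α * ∑ i, w i ^ 2 ≤ Torus.symb Sstar n w)
    (hI : InInterval Sstar lam S)
    (q : OrthonormalBasis (Fin 3) ℝ (EuclideanSpace ℝ (Fin 3))) (βk : Fin 3 → ℝ)
    (hq : ∀ k, (regBlock Sstar n).mulVec (q k) = βk k • ⇑(q k)) (hβk : ∀ k, 0 < βk k)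
    {ρ T : ℝ} (hρ : 0 < ρ) (hρ2 : ρ ≤ 1 / 2) (hT : 0 < T) (p : Fin 3 → ℝ) :
    (1 - 4 * ρ / 3) / lam * ∑ k, (∑ i, q k i * (projPerp n).mulVec p i) ^ 2 / βk k
        - ((1 - 4 * ρ / 3) / (α / lam) - qsRespScalar ρ T (α / lam)) * (∑ i, p i ^ 2 - (∑ i, p i * n i) ^ 2) ≤
      ∑ i, ∑ j, p i * (qsResp ρ T (regBlock S n) * projPerp n) i j * p j := by
  have hl0 : 0 < lam := by linarith
  rw [sum_sum_mul_qsResp_regBlock_projPerp hn, ← sum_sq_projPerp_mulVec hn]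
  set v := (projPerp n).mulVec p with hv
  have hB1symm : (lam • regBlock Sstar n).IsSymm := (regBlock_isSymm hSstar hn).smul _
  have hq1 : ∀ k, (lam • regBlock Sstar n).mulVec (q k) = (fun k => lam * βk k) k • ⇑(q k) :=
    fun k => smul_mulVec_of_eig (hq k) _
  have h := sum_sum_mul_qsResp_mul_ge_of_loewner' (regBlock_isSymm hS hn) hB1symm (div_pos hα0 hl0)
    (regBlock_floor_of_inInterval hn hlam hαl hα hI) (regBlock_loewner_upper_of_inInterval hn hlam hI)
    q (fun k => lam * βk k) hq1 hρ hρ2 hT v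
  have e : (1 - 4 * ρ / 3) * ∑ k, (∑ i, q k i * v i) ^ 2 / (lam * βk k)
      = (1 - 4 * ρ / 3) / lam * ∑ k, (∑ i, q k i * v i) ^ 2 / βk k := by
    rw [Finset.mul_sum, Finset.mul_sum]
    refine Finset.sum_congr rfl fun k _ => ?_
    have hk := (hβk k).ne'
    field_simp
  rw [e] at h
  exact h

end Eig

end Summit.AnomalousDissipation.AnomalousDissipation.Theorems.SolenoidalFractalHomogenisation.LagrangianStep
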